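import Summits.CriticalPhenomena.CardyFormulaZ2.Theorems.CardyComplexConeParafermionToSLESixFamiliesPercKSBoxFaceReduction
import Literature.Probability.RandomPlanarGeometry.KSRegularityOfConditionG2
import HarnessLib

/-!
# Stub `stub_percFaceBoxTight` (crux stmt-CriticalPhenomena-11395, line `registered`): conditional reduction

Route `CardyDualCurrent` (sub-problem `CriticalPhenomena/CardyFormulaZ2`), crux
`Summit.CriticalPhenomena.CardyFormulaZ2.Theses.CardyDualCurrent.MartingaleToSLE6`, skeleton
`Cruxes/MartingaleToSLE6/Lines/birth.lean` (r2), stub S1 `stub_percFaceBoxTight : PercFaceBoxTight`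
(`Theorems/CardyComplexConeParafermionToSLESixFamiliesPercKSBoxFaceReduction.lean`; shared verbatim
with stmt-CriticalPhenomena-11389): Kemppainen–Smirnov box tightness of the raw medial exploration
polyline `bondInterfaceIn D (Λ δ_k)` of every bond-percolation discretisation family, read through
chordal uniformizers `φ_k → φ` of the oriented face domains `D_k := orientedFaceDomain hΛ (hadm k)`.

## Status: the stub is NOT proved here (assessment)

`PercFaceBoxTight` is KS17 Prop. 3.2 / Thms. 3.9–3.10 (A. Kemppainen, S. Smirnov, Ann. Probab. 45
(2017), §3) fed with Condition G2 for the percolation interface (KS17 §4.1–4.2, from RSW), for a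
NON-simple lattice curve. None of the three layers is in the tree today:

1. the probabilistic half of KS17 is the UNPROVED named fact
   `Literature.Probability.RandomPlanarGeometry.exists_regularity_of_conditionG2`
   (`KSRegularityOfConditionG2.lean`, simple curves only; ~25 pp. of KS17 §3 + App. A);
2. Condition G2 (`ConditionG2`, `CrossingCondition.lean`) is proved for NO percolation interface law
   (the tree has RSW `rsw_half_holds` and Aizenman–Burchard curve-metric tightness
   `ZdDiscretisationFamily.isTightAlongMesh_bondInterfaceIn`, not the conditional annulus bound (16)
   at stopping times in the continuum form of `unforcedCrossingEvent`);
3. the raw polyline touches itself, so KS's fact does not apply to it verbatim: KS17 §4.1.2–4.1.4 pass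
   to a simple `2η`-separated modification on the modified medial (square–octagon) lattice, and box
   membership must be carried back to the raw curve (a Loewner-transform perturbation statement).

## What this file proves (sorry-free): `PercFaceBoxTight` from (1) and inlined forms of (2), (3)

* `percFaceBoxTight_of_conditionG2_of_transfer` — from the named fact (1), from laws `μ_k` on curve
  classes carried by simple chordal curves of `(D_k; a_k, b_k)` satisfying Condition G2 (the literal
  inputs `hsupp`, `hG2` of `exists_pairBox_of_conditionG2`) together with an EVENTUAL transfer
  inequality `Pc (γ_k ∉ B'_k) ≤ μ_k (B_kᶜ) + ε` for all large `k` (box `B ↦ B'` uniform in `k`,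
  slack `ε` free), and from per-scale box tightness of the raw interface at every fixed positive
  admissible mesh (the finitely many small `k`; absorbed by merging finitely many boxes, boxes being
  monotone in their moduli — `pairBox_mono`, `exists_box_forall_of_eventually`). The marked points
  converge by the landed `tendsto_pt_orientedFaceDomain`.
* `percFaceBoxTight_of_conditionG2_of_modification` — the COUPLED form: a modification map
  `γm hΛ hadm : BondConfig (Site 2) → CurveClass ℂ` on the percolation space (intended: KS's
  square–octagon modification of the exploration polyline), measurable with measurable range,
  pathwise a simple chordal curve of the oriented face domain with diverging height at `b_k`,
  whose push-forward laws satisfy ONE Condition G2 over all Dobrushin domains, families and positive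
  admissible meshes (the `q = 1` case of KS17 Prop. 4.3, by the RSW argument of Prop. 4.7 /
  Remark 4.8, for bond percolation on `ℤ²`), plus the eventual pathwise transfer `Pc {γm ∈ B_k, γ_k ∉ B'_k} ≤ ε` and the per-scale tightness.

Every hypothesis is an explicit proposition in the binder (no new `def`); they are the fileable
items that S1 still needs: (i) the named fact; (ii) = `hsupp` + `hG2` of the coupled form;
(iii) = `htr`; (iv) = `hfin` (each fixed-scale raw interface is carried, up to `ε`, by ONE box of
generated Loewner pairs through any chordal uniformizer of its oriented face domain — Loewner
describability of a lattice polyline, finite range). Wording risks recorded, not resolved: the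
tree's `ConditionG2` is the continuum form (a crossing is unforced when the crossed component of
`A ∩ (U ∖ γ[0, τ])` does not separate the tip from `b` in the CONTINUUM), at first hitting times of
closed sets; a discharge of (ii) must check that mesh-scale passages of `D_k ∖ γ̂[0, τ]` closed to
the lattice curve (adjacent obstacles, boundary conditions) create no certain continuum-unforced
crossing (KS17 Remark 2.2, the "scales below `η`" remark of §4.1.4, proof of Prop. 4.3; note 4 of
`KSRegularityOfConditionG2.lean`). The transfer (iii) with slack `ε` is a consequence of
`PercFaceBoxTight` itself (take `B'` from it), so hypothesising it costs no generality.

References: A. Kemppainen, S. Smirnov, Ann. Probab. 45 (2017) 698–779 (arXiv:1212.6215): Prop. 3.2,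
Prop. 3.8, Thm. 3.9, Thm. 3.10, §3.5; §4.1.2–4.1.4 (modified medial lattice, admissible domains,
`2η`-separation), Prop. 4.3 with Remark 4.8 and Prop. 4.7 (Condition G2 for FK / percolation
interfaces from crossing estimates / RSW). [KemppainenSmirnov2017]
-/

noncomputable section

open scoped Topology NNReal ENNReal unitInterval
open Filter Set MeasureTheory Metric
open UpperHalfPlane (upperHalfPlaneSet)
open Literature.Probability Literature.Probability.LatticeModels Literature.Probability.Percolation
open Literature.Probability.RandomPlanarGeometry
open scoped Literature.Probability.RandomPlanarGeometry.PathBorel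

namespace Summit.CriticalPhenomena.CardyFormulaZ2.Cruxes.MartingaleToSLE6.Birth

open Summit.CriticalPhenomena.CardyFormulaZ2.Cruxes.ParafermionToSLESixFamilies.CaratheodoryNetSlitUniformity
  (Pc PercFaceBoxTight)
-- buildfix lane 2026-08-20: namespace-local alias(es) so that short names made ambiguous by the
-- 2026-08-15 Literature migration (old home vs re-exported new home, both in the import cone) resolve,
-- as in the accepted build, to the OLD home `Literature.Probability.Percolation`. No declaration text changes.
export Literature.Probability.Percolation (bondInterfaceIn bondInterfaceIn_apply)

/-! ### Elementary tools: monotone boxes, merging finitely many boxes, a union bound -/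

/-- **Boxes of Loewner pairs are monotone in their moduli**: weakening the curve and driving moduli
(`δγ' ≤ δγ`, `δW' ≤ δW` pointwise) and delaying the transience profile (`T ≤ T'`) enlarges the box
`{p ∈ generatedPairs | p.1 ∈ modulusSet {0} δγ, p.2 ∈ modulusSet {0} δW, ‖p.1 t‖ ≥ j for t ≥ T j}`.
[folklore] -/
theorem pairBox_mono {δγ δW δγ' δW' : ℕ → ℝ} {T T' : ℕ → ℝ≥0}
    (h1 : ∀ j, δγ' j ≤ δγ j) (h2 : ∀ j, δW' j ≤ δW j) (h3 : ∀ j, T j ≤ T' j) :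
    {p : C(ℝ≥0, ℂ) × C(ℝ≥0, ℝ) | p ∈ generatedPairs ∧
        p.1 ∈ Process.modulusSet ({0} : Set ℂ) δγ ∧ p.2 ∈ Process.modulusSet ({0} : Set ℝ) δW ∧
        ∀ (j : ℕ) (t : ℝ≥0), T j ≤ t → (j : ℝ) ≤ ‖p.1 t‖} ⊆
      {p : C(ℝ≥0, ℂ) × C(ℝ≥0, ℝ) | p ∈ generatedPairs ∧
        p.1 ∈ Process.modulusSet ({0} : Set ℂ) δγ' ∧ p.2 ∈ Process.modulusSet ({0} : Set ℝ) δW' ∧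
        ∀ (j : ℕ) (t : ℝ≥0), T' j ≤ t → (j : ℝ) ≤ ‖p.1 t‖} := by
  rintro p ⟨hg, hγ, hW, hT⟩
  exact ⟨hg, ⟨hγ.1, fun k s t hs ht hst ↦ hγ.2 k s t hs ht (hst.trans (h1 k))⟩,
    ⟨hW.1, fun k s t hs ht hst ↦ hW.2 k s t hs ht (hst.trans (h2 k))⟩,
    fun j t hjt ↦ hT j t ((h3 j).trans hjt)⟩

/-- **Merging finitely many boxes** (the `∀ k` form of a box clause from its eventual form and a
per-index form). For a family of sets `S a b c` antitone in `(a, b)` and monotone in `c`, and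
set-functions `f k` that are antitone, if ONE triple of positive moduli bounds `f k (S a b c) ≤ ε`
for all `k ≥ N` and every single `k` admits its own triple, then one triple serves all `k`:
take pointwise `min` / `min` / `max` of the `N + 1` triples. [folklore] -/
theorem exists_box_forall_of_eventually {P : Type*} (S : (ℕ → ℝ) → (ℕ → ℝ) → (ℕ → ℝ≥0) → Set P)
    (hS : ∀ {a a' b b' : ℕ → ℝ} {c c' : ℕ → ℝ≥0}, (∀ j, a' j ≤ a j) → (∀ j, b' j ≤ b j) →
      (∀ j, c j ≤ c' j) → S a b c ⊆ S a' b' c')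
    (f : ℕ → Set P → ℝ≥0∞) (hf : ∀ (k : ℕ) {s s' : Set P}, s ⊆ s' → f k s' ≤ f k s)
    {ε : ℝ≥0∞} {N : ℕ}
    (htail : ∃ (a b : ℕ → ℝ) (c : ℕ → ℝ≥0), (∀ j, 0 < a j) ∧ (∀ j, 0 < b j) ∧
      ∀ k, N ≤ k → f k (S a b c) ≤ ε)
    (hfin : ∀ k, ∃ (a b : ℕ → ℝ) (c : ℕ → ℝ≥0), (∀ j, 0 < a j) ∧ (∀ j, 0 < b j) ∧
      f k (S a b c) ≤ ε) :
    ∃ (a b : ℕ → ℝ) (c : ℕ → ℝ≥0), (∀ j, 0 < a j) ∧ (∀ j, 0 < b j) ∧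
      ∀ k, f k (S a b c) ≤ ε := by
  obtain ⟨a₀, b₀, c₀, ha₀, hb₀, h₀⟩ := htail
  have claim : ∀ n : ℕ, ∃ (a b : ℕ → ℝ) (c : ℕ → ℝ≥0), (∀ j, 0 < a j) ∧ (∀ j, 0 < b j) ∧
      S a₀ b₀ c₀ ⊆ S a b c ∧ ∀ k < n, f k (S a b c) ≤ ε := by
    intro n
    induction n with
    | zero => exact ⟨a₀, b₀, c₀, ha₀, hb₀, Subset.rfl, fun k hk ↦ absurd hk (Nat.not_lt_zero k)⟩
    | succ n ih =>
      obtain ⟨a, b, c, ha, hb, hsub, hlt⟩ := ih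
      obtain ⟨a₁, b₁, c₁, ha₁, hb₁, hn⟩ := hfin n
      have e1 : S a b c ⊆
          S (fun j ↦ min (a j) (a₁ j)) (fun j ↦ min (b j) (b₁ j)) (fun j ↦ max (c j) (c₁ j)) :=
        hS (fun j ↦ min_le_left _ _) (fun j ↦ min_le_left _ _) (fun j ↦ le_max_left _ _)
      have e2 : S a₁ b₁ c₁ ⊆
          S (fun j ↦ min (a j) (a₁ j)) (fun j ↦ min (b j) (b₁ j)) (fun j ↦ max (c j) (c₁ j)) :=
        hS (fun j ↦ min_le_right _ _) (fun j ↦ min_le_right _ _) (fun j ↦ le_max_right _ _)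
      refine ⟨_, _, _, fun j ↦ lt_min (ha j) (ha₁ j), fun j ↦ lt_min (hb j) (hb₁ j),
        hsub.trans e1, fun k hk ↦ ?_⟩
      rcases Nat.lt_succ_iff_lt_or_eq.1 hk with hk | rfl
      · exact (hf k e1).trans (hlt k hk)
      · exact (hf k e2).trans hn
  obtain ⟨a, b, c, ha, hb, hsub, hlt⟩ := claim N
  exact ⟨a, b, c, ha, hb, fun k ↦ (lt_or_ge k N).elim (hlt k) fun hk ↦ (hf k hsub).trans (h₀ k hk)⟩

/-- **Union bound behind the coupled transfer**: `{g ∉ B'} ⊆ {f ∉ B} ∪ {f ∈ B, g ∉ B'}`, and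
`μ {f ∉ B} ≤ (f_* μ) Bᶜ` for an a.e.-measurable `f` (outer-measure form, no measurability of `B`,
`B'` needed). [folklore] -/
theorem measure_preimage_compl_le_map_add {Ω X : Type*} [MeasurableSpace Ω] [MeasurableSpace X]
    (μ : Measure Ω) {f : Ω → X} (g : Ω → X) (hf : AEMeasurable f μ) (B B' : Set X) :
    μ (g ⁻¹' B'ᶜ) ≤ μ.map f Bᶜ + μ {ω | f ω ∈ B ∧ g ω ∉ B'} := by
  calc μ (g ⁻¹' B'ᶜ) ≤ μ (f ⁻¹' Bᶜ ∪ {ω | f ω ∈ B ∧ g ω ∉ B'}) := by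
        refine measure_mono fun ω hω ↦ ?_
        by_cases hB : f ω ∈ B
        · exact Or.inr ⟨hB, hω⟩
        · exact Or.inl hB
    _ ≤ μ (f ⁻¹' Bᶜ) + μ {ω | f ω ∈ B ∧ g ω ∉ B'} := measure_union_le _ _
    _ ≤ μ.map f Bᶜ + μ {ω | f ω ∈ B ∧ g ω ∉ B'} := add_le_add (Measure.le_map_apply hf _) le_rfl

/-! ### The conditional reduction (laws form) -/

/-- **`PercFaceBoxTight` from Kemppainen–Smirnov's theorem, Condition G2 for simple modifications,
an eventual transfer, and per-scale tightness.** Hypotheses, all inlined: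
* `hKS` — the named fact `exists_regularity_of_conditionG2` (KS17 Prop. 3.2, Prop. 3.8, Thm. 3.9,
  Thm. 3.10, §3.5; simple curves, approximating domains), UNPROVED in the tree;
* `hmod` — for every Dobrushin domain, family, chordal map `φ`, positive admissible meshes
  `δ_k → 0` and chordal maps `φ_k` of the oriented face domains `D_k` with (U1), (U2): probability
  laws `μ_k` on curve classes, (a) carried by simple chordal curves of `(D_k; a_k, b_k)` with
  diverging height at `b_k` through `φ_k` (KS's `X_simple`, the clause `hsupp` of the fact),
  (b) Condition G2 for `{(D_k, a_k, b_k, μ_k)}` (the `q = 1` case of KS17 Prop. 4.3 for the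
  interface on the modified medial lattice of `ℤ²`, by the RSW argument of Prop. 4.7 / Remark 4.8),
  (c) the EVENTUAL transfer: for every box `(δγ, δW, T)` and `ε > 0` one
  box `(δγ', δW', T')` with `Pc (γ_k ∉ ⟦Φ_k ∘ pr₁⟧ '' box') ≤ μ_k ((⟦Φ_k ∘ pr₁⟧ '' box)ᶜ) + ε`
  for all large `k` (intended: `μ_k` = law of KS's square–octagon modification of `γ_k`, at
  sup-distance `O(δ_k)`, and continuity of the Loewner transform at regular curves);
* `hfin` — per-scale box tightness of the raw interface: at every fixed positive admissible mesh,
  through any chordal uniformizer `ψ` of the oriented face domain, for every `ε > 0` ONE box carries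
  `bondInterfaceIn D (Λ δ)` up to `Pc`-mass `ε` (Loewner describability of the finitely many
  lattice polylines of one scale; needed because `PercFaceBoxTight` asks `∀ k`, not `∀ᶠ k`).
Proof: `b_k → b` (`tendsto_pt_orientedFaceDomain`), `exists_pairBox_of_conditionG2` at `ε/2`,
transfer at `ε/2`, then `exists_box_forall_of_eventually` with `pairBox_mono`. -/
theorem percFaceBoxTight_of_conditionG2_of_transfer :
    exists_regularity_of_conditionG2 →
    (∀ (D : DobrushinDomain) (Λ : ℝ → DiscreteDobrushin) (hΛ : ZdDiscretisationFamily D Λ)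
      (φ : ConformalEquiv upperHalfPlaneSet D.carrier), D.IsChordalUniformizing φ →
      ∀ (δs : ℕ → ℝ), (∀ k, 0 < δs k) → Tendsto δs atTop (𝓝 0) →
      ∀ (hadm : ∀ k, (Λ (δs k)).IsZdAdmissible)
        (φs : ∀ k, ConformalEquiv upperHalfPlaneSet (orientedFaceDomain hΛ (hadm k)).carrier),
        (∀ k, (orientedFaceDomain hΛ (hadm k)).IsChordalUniformizing (φs k)) →
        (∀ R : ℝ, TendstoUniformlyOn (fun k ↦ (φs k).boundaryExtension) φ.boundaryExtension
          atTop ({z : ℂ | 0 ≤ z.im} ∩ closedBall 0 R)) →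
        (∀ ε : ℝ, 0 < ε → ∃ r : ℝ, ∀ᶠ k in atTop, ∀ z : ℂ, z ∈ {z : ℂ | 0 ≤ z.im} → r ≤ ‖z‖ →
          dist ((φs k).boundaryExtension z) ((orientedFaceDomain hΛ (hadm k)).pt 1) ≤ ε) →
        ∃ μs : ℕ → Measure (CurveClass ℂ), (∀ k, IsProbabilityMeasure (μs k)) ∧
          (∀ k, ∀ᵐ x ∂μs k, ∃ c : Curve ℂ, CurveClass.mk c = x ∧
            c 0 = (orientedFaceDomain hΛ (hadm k)).pt 0 ∧
            c 1 = (orientedFaceDomain hΛ (hadm k)).pt 1 ∧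
            (∀ s : I, 0 < (s : ℝ) → (s : ℝ) < 1 →
              c s ∈ (orientedFaceDomain hΛ (hadm k)).carrier) ∧
            InjOn c {s : I | 0 < (s : ℝ) ∧ (s : ℝ) < 1} ∧
            Tendsto (fun u : ℝ ↦ ((φs k).symm (IccExtend zero_le_one c u)).im)
              (𝓝[<] 1) atTop) ∧
          ConditionG2 (Set.range fun k : ℕ ↦
            (⟨(orientedFaceDomain hΛ (hadm k)).carrier, (orientedFaceDomain hΛ (hadm k)).pt 0,
              (orientedFaceDomain hΛ (hadm k)).pt 1, μs k⟩ : MarkedLaw)) ∧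
          ∀ (δγ δW : ℕ → ℝ) (T : ℕ → ℝ≥0), (∀ j, 0 < δγ j) → (∀ j, 0 < δW j) →
            ∀ ε : ℝ≥0∞, 0 < ε → ∃ (δγ' δW' : ℕ → ℝ) (T' : ℕ → ℝ≥0), (∀ j, 0 < δγ' j) ∧
              (∀ j, 0 < δW' j) ∧
              ∀ᶠ k in atTop, Pc ((bondInterfaceIn D (Λ (δs k))) ⁻¹'
                ((fun p ↦ compactifiedClass (φs k).boundaryExtension
                    ((orientedFaceDomain hΛ (hadm k)).pt 1) p.1) ''
                  {p : C(ℝ≥0, ℂ) × C(ℝ≥0, ℝ) | p ∈ generatedPairs ∧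
                    p.1 ∈ Process.modulusSet ({0} : Set ℂ) δγ' ∧
                    p.2 ∈ Process.modulusSet ({0} : Set ℝ) δW' ∧
                    ∀ (j : ℕ) (t : ℝ≥0), T' j ≤ t → (j : ℝ) ≤ ‖p.1 t‖})ᶜ) ≤
                μs k ((fun p ↦ compactifiedClass (φs k).boundaryExtension
                    ((orientedFaceDomain hΛ (hadm k)).pt 1) p.1) ''
                  {p : C(ℝ≥0, ℂ) × C(ℝ≥0, ℝ) | p ∈ generatedPairs ∧
                    p.1 ∈ Process.modulusSet ({0} : Set ℂ) δγ ∧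
                    p.2 ∈ Process.modulusSet ({0} : Set ℝ) δW ∧
                    ∀ (j : ℕ) (t : ℝ≥0), T j ≤ t → (j : ℝ) ≤ ‖p.1 t‖})ᶜ + ε) →
    (∀ (D : DobrushinDomain) (Λ : ℝ → DiscreteDobrushin) (hΛ : ZdDiscretisationFamily D Λ)
      (δ : ℝ), 0 < δ → ∀ (hadm : (Λ δ).IsZdAdmissible)
        (ψ : ConformalEquiv upperHalfPlaneSet (orientedFaceDomain hΛ hadm).carrier),
        (orientedFaceDomain hΛ hadm).IsChordalUniformizing ψ →
        ∀ ε : ℝ≥0∞, 0 < ε → ∃ (δγ δW : ℕ → ℝ) (T : ℕ → ℝ≥0), (∀ j, 0 < δγ j) ∧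
          (∀ j, 0 < δW j) ∧
          Pc ((bondInterfaceIn D (Λ δ)) ⁻¹'
            ((fun p ↦ compactifiedClass ψ.boundaryExtension
                ((orientedFaceDomain hΛ hadm).pt 1) p.1) ''
              {p : C(ℝ≥0, ℂ) × C(ℝ≥0, ℝ) | p ∈ generatedPairs ∧
                p.1 ∈ Process.modulusSet ({0} : Set ℂ) δγ ∧
                p.2 ∈ Process.modulusSet ({0} : Set ℝ) δW ∧
                ∀ (j : ℕ) (t : ℝ≥0), T j ≤ t → (j : ℝ) ≤ ‖p.1 t‖})ᶜ) ≤ ε) →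
    PercFaceBoxTight := by
  intro hKS hmod hfin D Λ hΛ φ hφ δs hpos hlim hadm φs hφs hU1 hU2 ε hε
  obtain ⟨μs, hμs, hsupp, hG2, htr⟩ := hmod D Λ hΛ φ hφ δs hpos hlim hadm φs hφs hU1 hU2
  have hb := (tendsto_pt_orientedFaceDomain hΛ hpos hlim hadm).2
  have hε2 : (0 : ℝ≥0∞) < ε / 2 := ENNReal.half_pos hε.ne'
  obtain ⟨δγ, δW, T, hδγ, hδW, hbox⟩ :=
    exists_pairBox_of_conditionG2 (Ds := fun k ↦ orientedFaceDomain hΛ (hadm k)) (hμs := hμs)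
      hKS hφ hφs hU1 hU2 hb hsupp hG2 (ε / 2) hε2
  obtain ⟨δγ', δW', T', hδγ', hδW', hbox'⟩ := htr δγ δW T hδγ hδW (ε / 2) hε2
  obtain ⟨N, hN⟩ := eventually_atTop.1 hbox'
  refine exists_box_forall_of_eventually
    (fun (a b : ℕ → ℝ) (c : ℕ → ℝ≥0) ↦ {p : C(ℝ≥0, ℂ) × C(ℝ≥0, ℝ) | p ∈ generatedPairs ∧
        p.1 ∈ Process.modulusSet ({0} : Set ℂ) a ∧ p.2 ∈ Process.modulusSet ({0} : Set ℝ) b ∧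
        ∀ (j : ℕ) (t : ℝ≥0), c j ≤ t → (j : ℝ) ≤ ‖p.1 t‖})
    (fun h1 h2 h3 ↦ pairBox_mono h1 h2 h3)
    (fun k s ↦ Pc ((bondInterfaceIn D (Λ (δs k))) ⁻¹'
      ((fun p : C(ℝ≥0, ℂ) × C(ℝ≥0, ℝ) ↦ compactifiedClass (φs k).boundaryExtension
        ((orientedFaceDomain hΛ (hadm k)).pt 1) p.1) '' s)ᶜ))
    (fun k s s' h ↦ measure_mono (preimage_mono (compl_subset_compl.2 (image_mono h))))
    (N := N) ⟨δγ', δW', T', hδγ', hδW', fun k hk ↦ (hN k hk).trans ?_⟩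
    (fun k ↦ hfin D Λ hΛ (δs k) (hpos k) (hadm k) (φs k) (hφs k) ε hε)
  calc μs k _ + ε / 2 ≤ ε / 2 + ε / 2 := add_le_add (hbox k) le_rfl
    _ = ε := ENNReal.add_halves ε

/-! ### The conditional reduction (coupled form: a modification map on the percolation space) -/

/-- **`PercFaceBoxTight` from Kemppainen–Smirnov's theorem and a simple modification of the
exploration polyline satisfying Condition G2** (the coupled form of
`percFaceBoxTight_of_conditionG2_of_transfer`, hypotheses separately fileable once the map `γm`
is fixed). Data and hypotheses, all inlined:
* `γm hΛ hadm : BondConfig (Site 2) → CurveClass ℂ` — a modification of the interface at ONE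
  admissible mesh (intended: the exploration path on KS's modified medial lattice, KS17 §4.1.2,
  re-oriented like `bondInterfaceIn`), measurable with measurable range (`hmeas`; a lattice curve
  in a bounded domain has finite range);
* `hsupp` — pathwise, `γm` is a SIMPLE chordal curve of the oriented face domain (`c 0 = pt 0`,
  `c 1 = pt 1`, `c(0,1) ⊆ carrier`, injective on `(0,1)`) with diverging height at `pt 1` through
  every chordal uniformizer (KS17 §4.1.4: `2η`-separation; Lawler Prop. 4.4 input);
* `hG2` — ONE Condition G2 for the whole collection of push-forward laws over all Dobrushin
  domains, discretisation families and positive admissible meshes, in the oriented face domains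
  (the `q = 1` case of KS17 Prop. 4.3, by the RSW argument of Prop. 4.7 / Remark 4.8: RSW for
  bond percolation on `ℤ²`, `rsw_half_holds`, + domain Markov; the constant `C` is a lattice
  constant) — stated in the tree's continuum, hitting-time form `ConditionG2`;
* `htr` — the eventual pathwise transfer with slack: for every box and `ε > 0` one box `B'` with
  `Pc {γm ∈ ⟦Φ_k ∘ pr₁⟧ '' box, γ_k ∉ ⟦Φ_k ∘ pr₁⟧ '' box'} ≤ ε` for all large `k`;
* `hfin` — per-scale box tightness of the raw interface (as in the laws form);
* `hKS` — the named fact.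
Proof: `μ_k := (γm)_* Pc`; `isProbabilityMeasure_map`, `ae_map_mem_range`, `ConditionG2.mono`,
and the union bound `measure_preimage_compl_le_map_add`. -/
theorem percFaceBoxTight_of_conditionG2_of_modification
    (hKS : exists_regularity_of_conditionG2)
    (γm : ∀ ⦃D : DobrushinDomain⦄ ⦃Λ : ℝ → DiscreteDobrushin⦄, ZdDiscretisationFamily D Λ →
      ∀ ⦃δ : ℝ⦄, (Λ δ).IsZdAdmissible → BondConfig (Site 2) → CurveClass ℂ)
    (hmeas : ∀ (D : DobrushinDomain) (Λ : ℝ → DiscreteDobrushin) (hΛ : ZdDiscretisationFamily D Λ)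
      (δ : ℝ) (hadm : (Λ δ).IsZdAdmissible), 0 < δ →
      Measurable (γm hΛ hadm) ∧ MeasurableSet (range (γm hΛ hadm)))
    (hsupp : ∀ (D : DobrushinDomain) (Λ : ℝ → DiscreteDobrushin) (hΛ : ZdDiscretisationFamily D Λ)
      (δ : ℝ) (hadm : (Λ δ).IsZdAdmissible)
      (ψ : ConformalEquiv upperHalfPlaneSet (orientedFaceDomain hΛ hadm).carrier),
      (orientedFaceDomain hΛ hadm).IsChordalUniformizing ψ → 0 < δ →
      ∀ ω, ∃ c : Curve ℂ, CurveClass.mk c = γm hΛ hadm ω ∧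
        c 0 = (orientedFaceDomain hΛ hadm).pt 0 ∧ c 1 = (orientedFaceDomain hΛ hadm).pt 1 ∧
        (∀ s : I, 0 < (s : ℝ) → (s : ℝ) < 1 → c s ∈ (orientedFaceDomain hΛ hadm).carrier) ∧
        InjOn c {s : I | 0 < (s : ℝ) ∧ (s : ℝ) < 1} ∧
        Tendsto (fun u : ℝ ↦ (ψ.symm (IccExtend zero_le_one c u)).im) (𝓝[<] 1) atTop)
    (hG2 : ConditionG2 {L : MarkedLaw | ∃ (D : DobrushinDomain) (Λ : ℝ → DiscreteDobrushin)
      (hΛ : ZdDiscretisationFamily D Λ) (δ : ℝ) (hadm : (Λ δ).IsZdAdmissible), 0 < δ ∧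
      L = ⟨(orientedFaceDomain hΛ hadm).carrier, (orientedFaceDomain hΛ hadm).pt 0,
        (orientedFaceDomain hΛ hadm).pt 1, Pc.map (γm hΛ hadm)⟩})
    (htr : ∀ (D : DobrushinDomain) (Λ : ℝ → DiscreteDobrushin) (hΛ : ZdDiscretisationFamily D Λ)
      (φ : ConformalEquiv upperHalfPlaneSet D.carrier), D.IsChordalUniformizing φ →
      ∀ (δs : ℕ → ℝ), (∀ k, 0 < δs k) → Tendsto δs atTop (𝓝 0) →
      ∀ (hadm : ∀ k, (Λ (δs k)).IsZdAdmissible)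
        (φs : ∀ k, ConformalEquiv upperHalfPlaneSet (orientedFaceDomain hΛ (hadm k)).carrier),
        (∀ k, (orientedFaceDomain hΛ (hadm k)).IsChordalUniformizing (φs k)) →
        (∀ R : ℝ, TendstoUniformlyOn (fun k ↦ (φs k).boundaryExtension) φ.boundaryExtension
          atTop ({z : ℂ | 0 ≤ z.im} ∩ closedBall 0 R)) →
        (∀ ε : ℝ, 0 < ε → ∃ r : ℝ, ∀ᶠ k in atTop, ∀ z : ℂ, z ∈ {z : ℂ | 0 ≤ z.im} → r ≤ ‖z‖ →
          dist ((φs k).boundaryExtension z) ((orientedFaceDomain hΛ (hadm k)).pt 1) ≤ ε) →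
        ∀ (δγ δW : ℕ → ℝ) (T : ℕ → ℝ≥0), (∀ j, 0 < δγ j) → (∀ j, 0 < δW j) →
          ∀ ε : ℝ≥0∞, 0 < ε → ∃ (δγ' δW' : ℕ → ℝ) (T' : ℕ → ℝ≥0), (∀ j, 0 < δγ' j) ∧
            (∀ j, 0 < δW' j) ∧
            ∀ᶠ k in atTop, Pc {ω | γm hΛ (hadm k) ω ∈
                (fun p ↦ compactifiedClass (φs k).boundaryExtension
                    ((orientedFaceDomain hΛ (hadm k)).pt 1) p.1) ''
                  {p : C(ℝ≥0, ℂ) × C(ℝ≥0, ℝ) | p ∈ generatedPairs ∧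
                    p.1 ∈ Process.modulusSet ({0} : Set ℂ) δγ ∧
                    p.2 ∈ Process.modulusSet ({0} : Set ℝ) δW ∧
                    ∀ (j : ℕ) (t : ℝ≥0), T j ≤ t → (j : ℝ) ≤ ‖p.1 t‖} ∧
              bondInterfaceIn D (Λ (δs k)) ω ∉
                (fun p ↦ compactifiedClass (φs k).boundaryExtension
                    ((orientedFaceDomain hΛ (hadm k)).pt 1) p.1) ''
                  {p : C(ℝ≥0, ℂ) × C(ℝ≥0, ℝ) | p ∈ generatedPairs ∧
                    p.1 ∈ Process.modulusSet ({0} : Set ℂ) δγ' ∧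
                    p.2 ∈ Process.modulusSet ({0} : Set ℝ) δW' ∧
                    ∀ (j : ℕ) (t : ℝ≥0), T' j ≤ t → (j : ℝ) ≤ ‖p.1 t‖}} ≤ ε)
    (hfin : ∀ (D : DobrushinDomain) (Λ : ℝ → DiscreteDobrushin) (hΛ : ZdDiscretisationFamily D Λ)
      (δ : ℝ), 0 < δ → ∀ (hadm : (Λ δ).IsZdAdmissible)
        (ψ : ConformalEquiv upperHalfPlaneSet (orientedFaceDomain hΛ hadm).carrier),
        (orientedFaceDomain hΛ hadm).IsChordalUniformizing ψ →
        ∀ ε : ℝ≥0∞, 0 < ε → ∃ (δγ δW : ℕ → ℝ) (T : ℕ → ℝ≥0), (∀ j, 0 < δγ j) ∧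
          (∀ j, 0 < δW j) ∧
          Pc ((bondInterfaceIn D (Λ δ)) ⁻¹'
            ((fun p ↦ compactifiedClass ψ.boundaryExtension
                ((orientedFaceDomain hΛ hadm).pt 1) p.1) ''
              {p : C(ℝ≥0, ℂ) × C(ℝ≥0, ℝ) | p ∈ generatedPairs ∧
                p.1 ∈ Process.modulusSet ({0} : Set ℂ) δγ ∧
                p.2 ∈ Process.modulusSet ({0} : Set ℝ) δW ∧
                ∀ (j : ℕ) (t : ℝ≥0), T j ≤ t → (j : ℝ) ≤ ‖p.1 t‖})ᶜ) ≤ ε) :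
    PercFaceBoxTight := by
  refine percFaceBoxTight_of_conditionG2_of_transfer hKS ?_ hfin
  intro D Λ hΛ φ hφ δs hpos hlim hadm φs hφs hU1 hU2
  have hf : ∀ k, AEMeasurable (γm hΛ (hadm k)) Pc := fun k ↦
    (hmeas D Λ hΛ (δs k) (hadm k) (hpos k)).1.aemeasurable
  refine ⟨fun k ↦ Pc.map (γm hΛ (hadm k)), fun k ↦ Measure.isProbabilityMeasure_map (hf k),
    fun k ↦ ?_, ?_, ?_⟩
  · filter_upwards [ae_map_mem_range (γm hΛ (hadm k))
      (hmeas D Λ hΛ (δs k) (hadm k) (hpos k)).2 Pc] with x hx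
    obtain ⟨ω, rfl⟩ := hx
    exact hsupp D Λ hΛ (δs k) (hadm k) (φs k) (hφs k) (hpos k) ω
  · refine hG2.mono ?_
    rintro _ ⟨k, rfl⟩
    exact ⟨D, Λ, hΛ, δs k, hadm k, hpos k, rfl⟩
  · intro δγ δW T hδγ hδW ε hε
    obtain ⟨δγ', δW', T', hδγ', hδW', h⟩ :=
      htr D Λ hΛ φ hφ δs hpos hlim hadm φs hφs hU1 hU2 δγ δW T hδγ hδW ε hε
    refine ⟨δγ', δW', T', hδγ', hδW', ?_⟩
    filter_upwards [h] with k hk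
    exact (measure_preimage_compl_le_map_add Pc (bondInterfaceIn D (Λ (δs k))) (hf k) _ _).trans
      (add_le_add le_rfl hk)

end Summit.CriticalPhenomena.CardyFormulaZ2.Cruxes.MartingaleToSLE6.Birth

end
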